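import Literature.NumberTheory.EllipticCurves.Kato2004.TorsionNonscalarWitnessProofs
import Literature.NumberTheory.EllipticCurves.Kato2004.Condition1252
import Literature.NumberTheory.EllipticCurves.PointDivisibilityProofs
import Literature.NumberTheory.EllipticCurves.GaloisActionProofs
import Mathlib.LinearAlgebra.Eigenspace.Zero
import HarnessLib

/-!
# An element of ORDER NINE on `E[9]` gives a witness fixing `E[3]` and non-scalar on `E[9]`;
# hence the `3`-adic tower from surj(3) + ONE `σ ∈ Γ_ℚ` with `σ³ = 1` on `E[3]`, `σ³ ≠ 1` on `E[9]`
# (cell `b2b-bsdres`, team n1011, seat p02 gen 4 — row T-b11 'm = 3: structure of the wild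
# inertia on E[9]'; pure algebra, no reduction hypothesis, no determinant hypothesis)

HONEST FRAMING (cell `b2b-bsdres`, run/shared/lean/b2b/bsd-rank1-residual/, verbatim in every
file): the goal of the cell is to DELETE the COMBINATION-SHAPED residual classes of the
Birch–Swinnerton-Dyer formula for ALL analytic-rank `≤ 1` elliptic curves over `ℚ` — "full BSD
formula for every rank `≤ 1` curve in class `C`" assembled STRICTLY from published theorems — so
that the rank-`≤ 1` remainder becomes exactly the CONSTRUCTION-SHAPED classes, which are TYPED
(missing-input `Prop`s), NOT attempted. This is not "finishing BSD". Team n1011 (N10 / N11):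
research route; no claim beyond the stated classes; labels UNCHANGED; nothing is booked. Theorems
only (no definition, no named fact).

## What this file proves

Let `E = W/ℚ` be an elliptic curve and `σ ∈ Γ_ℚ` with `σ³ = 1` on `E[3]` (`h3`) and `σ³ ≠ 1` on
`E[9]` (`h9`) — i.e. `ρ̄_{E,9}(σ)` has order `9` (an element of `GL₂(ℤ/9)` of order `9` reduces to an
element of order `3` of `GL₂(𝔽₃)`, and its cube lies in the kernel `1 + 3M₂`).  Then

* `smul_smul_sub_eq_of_pow_three_smul_eq` (§1) — `σ` is unipotent of ORDER TWO on `E[3]`: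
  `(σ − 1)² = 0` there.  Proof: `E[3]` is an `𝔽₃`-plane (`#E[3] = 9`), `(σ − 1)³ = σ³ − 1 = 0` on it,
  and a nilpotent endomorphism of a plane has square zero (Cayley–Hamilton:
  `LinearMap.isNilpotent_iff_charpoly`).
* `not_exists_scalar_pow_three_of_pow_three` (§2) — `σ³` is NOT a scalar `1 + 3m` on `E[9]`.
  Writing `N = σ − 1`: `N² E[9] ⊆ E[3]` (since `3·N²Q = N²(3Q) = 0`), `N⁴ = 0` and
  `σ³ = 1 + 3N + N³` on `E[9]`; a relation `3N + N³ = 3m` with `3 ∤ m`, applied to `N Q`, gives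
  `3m·NQ = N⁴Q = 0`, so `3N = 0`, so `N³ = N²∘N = 0` (as `N E[9] ⊆ E[3]`), so `3m = 0` on `E[9]`,
  absurd; with `3 ∣ m` the relation says `σ³ = 1` on `E[9]`, against `h9`.  Matrix shadow: for
  `h ∈ GL₂(ℤ/9)` over a transvection, `h³ = 1 + 3(1 + c)·N₀` is `1` or NON-SCALAR (all `432` elements
  of order `9` of `GL₂(ℤ/9)` have a non-scalar cube in `1 + 3M₂`; seat check `work/m3/gl2z9.py`).
* `towerSurj_three_of_surj_of_orderNine` (§3) — with `ρ̄_{E,3}` onto, `ρ̄_{E,3ⁿ}` is onto for every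
  `n` (n1011-p02 gen 2's torsion-level Serre lifting lemma
  `forall_hasSurjectiveModNGaloisRep_three_pow_of_fixing_torsion_of_nonscalar`, p252833, applied
  to `τ = σ³`), and `imageContainsSL2_three_of_surj_of_orderNine` — Kato's (12.5.2) at `3`.
  Contrapositive (the EXOTIC rows of N11, Elkies arXiv:math/0612734): if `ρ̄_{E,3}` is onto and
  `ρ̄_{E,9}` is not, then NO element of `Γ_ℚ` acts on `E[9]` with order divisible by `9`
  (`pow_three_smul_eq_self_of_surj_of_not_surj_nine`).

Use (row T-b11, this seat): at an additive potentially good WILD prime `3` with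
`v₃(j − 1728) = 3` the `3`-Sylow `P` of `ρ̄_{E,9}(I₃)` has order `≥ 9` (gen 3's valuations); by this
file `P` has exponent `3` on every EXOTIC row, which the local numerics (`HOME/b2b-bsdres-n1011-p02/
m3/`) turn into a decidable per-curve test.  Complements n1011-p14's
`NineTorsionUnipotentWitness.lean` (`(τ − 1)² = 0` on `E[9]`, determinant one) — here no
unipotency on `E[9]` and no determinant condition is assumed.  Nothing booked; no label change.

References: [SerreAbelianLadic1968] Ch. IV §3.4 Lemma 3 (IV-23); [Serre1972] §4.1;
[Elkies2006] N. D. Elkies, arXiv:math/0612734, §1–§2; [Kato2004Asterisque] (12.5.2) p. 222.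
-/

noncomputable section

open scoped Classical
open Polynomial WeierstrassCurve Literature.NumberTheory.EllipticCurves

namespace Summit.BirchSwinnertonDyer.Rank1Residual.GaloisImage

variable (W : WeierstrassCurve ℚ) [W.IsElliptic]

omit [W.IsElliptic] in
/-- `E[n]` is `Γ_ℚ`-stable. [folklore] -/
private theorem smul_mem_geomTorsion₉ {n : ℤ} (σ : Field.absoluteGaloisGroup ℚ) {P : W.geomPoints}
    (hP : P ∈ geomTorsion W n) : σ • P ∈ geomTorsion W n :=
  Literature.NumberTheory.EllipticCurves.smul_mem_torsionBy σ hP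

omit [W.IsElliptic] in
/-- Membership in `E[n]` as an equation. [folklore] -/
private theorem zsmul_eq_zero_of_mem₉ {n : ℤ} {P : W.geomPoints} (hP : P ∈ geomTorsion W n) :
    n • P = 0 :=
  (Submodule.mem_torsionBy_iff _ _).mp hP

omit [W.IsElliptic] in
/-- Membership in `E[n]` from the equation. [folklore] -/
private theorem mem_of_zsmul_eq_zero₉ {n : ℤ} {P : W.geomPoints} (hP : n • P = 0) :
    P ∈ geomTorsion W n :=
  (Submodule.mem_torsionBy_iff _ _).mpr hP

omit [W.IsElliptic] in
/-- Bézout at `3`: `9·X = 0`, `(3m)·X = 0`, `3 ∤ m` ⟹ `3·X = 0`. [folklore] -/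
private theorem three_smul_eq_zero_of_not_dvd {X : W.geomPoints} (h9 : (9 : ℕ) • X = 0) {m : ℕ}
    (hm : (3 * m) • X = 0) (h3m : ¬ 3 ∣ m) : (3 : ℕ) • X = 0 := by
  have hcop : Nat.Coprime m 3 := ((Nat.Prime.coprime_iff_not_dvd Nat.prime_three).mpr h3m).symm
  obtain ⟨b, -, hb⟩ := Nat.exists_mul_mod_eq_one_of_coprime hcop (by norm_num)
  have hdm : 3 * (m * b / 3) + 1 = m * b := by
    have := Nat.div_add_mod (m * b) 3
    rwa [hb] at this
  have h1 : (3 * (m * b)) • X = 0 := by rw [show 3 * (m * b) = b * (3 * m) by ring, mul_smul, hm, smul_zero]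
  rw [← hdm, mul_add, mul_one, add_smul, show 3 * (3 * (m * b / 3)) = (m * b / 3) * 9 by ring, mul_smul, h9,
    smul_zero, zero_add] at h1
  exact h1

/-! ### §1 `σ³ = 1` on `E[3]` forces `(σ − 1)² = 0` on `E[3]` (an `𝔽₃`-plane) -/

/-- **`σ³ = 1` on `E[3]` ⟹ `(σ − 1)² = 0` on `E[3]`.**  On the `𝔽₃`-plane `E[3]` (`#E[3] = 9`),
`(σ − 1)³ = σ³ − 1 = 0`; a nilpotent endomorphism of a plane has square zero (its characteristic
polynomial is `X²`, Cayley–Hamilton). [cite: Serre1972, §4.1] -/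
theorem smul_smul_sub_eq_of_pow_three_smul_eq (σ : Field.absoluteGaloisGroup ℚ)
    (h3 : ∀ P ∈ geomTorsion W 3, σ ^ 3 • P = P) :
    ∀ P ∈ geomTorsion W 3, σ • (σ • P - P) - (σ • P - P) = 0 := by
  haveI : Fact (Nat.Prime 3) := ⟨Nat.prime_three⟩
  -- the plane `A = E[3]` as an `𝔽₃`-vector space
  have h3A : ∀ x : geomTorsion W 3, (3 : ℕ) • x = 0 := fun x ↦ by
    apply Subtype.ext
    have h := zsmul_eq_zero_of_mem₉ W x.2
    have h' : ((3 : ℕ) : ℤ) • (x : W.geomPoints) = 0 := by exact_mod_cast h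
    rw [natCast_zsmul] at h'
    exact h'
  letI : Module (ZMod 3) (geomTorsion W 3) := AddCommGroup.zmodModule h3A
  have hcard : Nat.card (geomTorsion W 3) = 9 := by
    have h : Nat.card (geomTorsion W ((3 : ℕ) : ℤ)) = 3 ^ 2 :=
      card_torsionPoints_eq_sq_holds W (AlgebraicClosure ℚ) (n := 3) (by norm_num)
    exact_mod_cast h
  haveI : Finite (geomTorsion W 3) := Nat.finite_of_card_ne_zero (by rw [hcard]; norm_num)
  haveI : Module.Finite (ZMod 3) (geomTorsion W 3) := Module.Finite.of_finite
  have hrank : Module.finrank (ZMod 3) (geomTorsion W 3) = 2 := by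
    have h := Module.natCard_eq_pow_finrank (K := ZMod 3) (V := geomTorsion W 3)
    rw [hcard, Nat.card_zmod, show (9 : ℕ) = 3 ^ 2 by norm_num] at h
    exact (Nat.pow_right_injective (by norm_num : 2 ≤ 3) h).symm
  -- the endomorphism `N = σ − 1` of `A`
  set u : geomTorsion W 3 →+ geomTorsion W 3 :=
    DistribSMul.toAddMonoidHom (geomTorsion W 3) σ - AddMonoidHom.id _ with hu
  have hu_apply : ∀ x : geomTorsion W 3, ((u x : geomTorsion W 3) : W.geomPoints) =
      σ • (x : W.geomPoints) - x := fun x ↦ rfl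
  set φ : geomTorsion W 3 →ₗ[ZMod 3] geomTorsion W 3 := u.toZModLinearMap 3 with hφ
  have hφ_apply : ∀ x : geomTorsion W 3, φ x = u x := fun x ↦ rfl
  -- `N³ = 0` on `A`: `(σ − 1)³ = (σ³ − 1) + 3(σ − σ²)` and `3·E[3] = 0`
  have hc : ∀ X : W.geomPoints, (3 : ℕ) • σ • X = σ • (3 : ℕ) • X := fun X ↦ (smul_comm σ (3 : ℕ) X).symm
  have hN3 : ∀ P ∈ geomTorsion W 3,
      σ • (σ • (σ • P - P) - (σ • P - P)) - (σ • (σ • P - P) - (σ • P - P)) = 0 := by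
    intro P hP
    have h3P : (3 : ℕ) • P = 0 := by
      have h := zsmul_eq_zero_of_mem₉ W hP
      rwa [show (3 : ℤ) = ((3 : ℕ) : ℤ) by norm_num, natCast_zsmul] at h
    have hσ3 : σ • σ • σ • P = P := by
      have h := h3 P hP
      rwa [pow_three, mul_smul, mul_smul] at h
    have h3' : (3 : ℕ) • (σ • P - σ • σ • P) = 0 := by
      rw [smul_sub, hc, h3P, smul_zero, hc, hc, h3P, smul_zero, smul_zero, sub_self]
    have key : σ • (σ • (σ • P - P) - (σ • P - P)) - (σ • (σ • P - P) - (σ • P - P)) =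
        (σ • σ • σ • P - P) + (3 : ℕ) • (σ • P - σ • σ • P) := by
      simp only [smul_sub]
      abel
    rw [key, hσ3, sub_self, zero_add, h3']
  have hφ3 : φ ^ 3 = 0 := by
    refine LinearMap.ext fun x ↦ Subtype.ext ?_
    rw [pow_three, Module.End.mul_apply, Module.End.mul_apply, LinearMap.zero_apply,
      ZeroMemClass.coe_zero, hφ_apply, hφ_apply, hφ_apply, hu_apply, hu_apply, hu_apply]
    exact hN3 x x.2
  have hnil : IsNilpotent φ := ⟨3, hφ3⟩
  have hchar : φ.charpoly = X ^ 2 := by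
    rw [(LinearMap.isNilpotent_iff_charpoly φ).mp hnil, hrank]
  have hφ2 : φ ^ 2 = 0 := by
    have h := LinearMap.aeval_self_charpoly φ
    rwa [hchar, map_pow, aeval_X] at h
  intro P hP
  have h := LinearMap.congr_fun hφ2 ⟨P, hP⟩
  rw [pow_two, Module.End.mul_apply, LinearMap.zero_apply] at h
  have h' := congrArg Subtype.val h
  rw [hφ_apply, hφ_apply, hu_apply, hu_apply, ZeroMemClass.coe_zero] at h'
  exact h'

/-! ### §2 `σ³` is not a scalar `1 + 3m` on `E[9]` -/

/-- **Order nine ⟹ non-scalar cube.**  If `σ³ = 1` on `E[3]` and `σ³ ≠ 1` on `E[9]`, then `σ³`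
is not a scalar `1 + 3m` on `E[9]` (§2 of the module docstring; matrix form: an element of
`GL₂(ℤ/9)` of order `9` has a NON-SCALAR cube in `1 + 3M₂(ℤ/9)`).
[cite: Serre1972, §4.1] [cite: Elkies2006, §1] -/
theorem not_exists_scalar_pow_three_of_pow_three (σ : Field.absoluteGaloisGroup ℚ)
    (h3 : ∀ P ∈ geomTorsion W 3, σ ^ 3 • P = P) (h9 : ∃ Q ∈ geomTorsion W 9, σ ^ 3 • Q ≠ Q) :
    ¬ ∃ m : ℕ, ∀ Q ∈ geomTorsion W 9, σ ^ 3 • Q = (1 + 3 * m) • Q := by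
  -- notation: `N X = σ X − X`
  set N : W.geomPoints → W.geomPoints := fun X ↦ σ • X - X with hNdef
  have hN : ∀ X, N X = σ • X - X := fun X ↦ rfl
  have e : ∀ X, σ • X = X + N X := fun X ↦ by rw [hN]; abel
  have hNadd : ∀ X Y, N (X + Y) = N X + N Y := fun X Y ↦ by simp only [hN, smul_add]; abel
  have hNn : ∀ (k : ℕ) X, N (k • X) = k • N X := fun k X ↦ by
    simp only [hN, smul_comm σ k X, smul_sub]
  have hN0 : N 0 = 0 := by simp [hN]
  -- bookkeeping on `E[9]`, `E[3]`
  have h9Q : ∀ Q ∈ geomTorsion W 9, (9 : ℕ) • Q = 0 := fun Q hQ ↦ by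
    have h := zsmul_eq_zero_of_mem₉ W hQ
    rwa [show (9 : ℤ) = ((9 : ℕ) : ℤ) by norm_num, natCast_zsmul] at h
  have h3of9 : ∀ Q ∈ geomTorsion W 9, ∀ m : ℕ, 3 ∣ m → (3 * m) • Q = 0 := by
    intro Q hQ m ⟨k, hk⟩
    rw [hk, show 3 * (3 * k) = k * 9 by ring, mul_smul, h9Q Q hQ, smul_zero]
  have hmem3_iff : ∀ X : W.geomPoints, X ∈ geomTorsion W 3 ↔ (3 : ℕ) • X = 0 := fun X ↦ by
    rw [show geomTorsion W 3 = geomTorsion W ((3 : ℕ) : ℤ) by norm_num]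
    exact (Submodule.mem_torsionBy_iff _ _).trans (by rw [natCast_zsmul])
  have hmem9N : ∀ Q ∈ geomTorsion W 9, N Q ∈ geomTorsion W 9 := fun Q hQ ↦
    (geomTorsion W 9).sub_mem (smul_mem_geomTorsion₉ W σ hQ) hQ
  have h3Q : ∀ Q ∈ geomTorsion W 9, (3 : ℕ) • Q ∈ geomTorsion W 3 := fun Q hQ ↦ by
    rw [hmem3_iff, ← mul_smul, show (3 : ℕ) * 3 = 9 by norm_num]
    exact h9Q Q hQ
  -- §1: `N² = 0` on `E[3]`
  have hNN3 : ∀ P ∈ geomTorsion W 3, N (N P) = 0 := fun P hP ↦ by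
    have h := smul_smul_sub_eq_of_pow_three_smul_eq W σ h3 P hP
    simpa only [hN] using h
  -- `N² Q ∈ E[3]` for `Q ∈ E[9]` (as `3 N²Q = N²(3Q) = 0`), hence `N⁴ Q = 0`
  have hNN9 : ∀ Q ∈ geomTorsion W 9, N (N Q) ∈ geomTorsion W 3 := fun Q hQ ↦ by
    rw [hmem3_iff, ← hNn, ← hNn]
    exact hNN3 _ (h3Q Q hQ)
  have hN4 : ∀ Q ∈ geomTorsion W 9, N (N (N (N Q))) = 0 := fun Q hQ ↦ hNN3 _ (hNN9 Q hQ)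
  -- `σ³ X = X + 3 N X + 3 N² X + N³ X` for every `X`, and `3 N² Q = 0` on `E[9]`
  have hcube : ∀ X, σ ^ 3 • X = X + (3 : ℕ) • N X + (3 : ℕ) • N (N X) + N (N (N X)) := fun X ↦ by
    simp only [hN, smul_sub, pow_three, mul_smul]
    abel
  have hσ3 : ∀ Q ∈ geomTorsion W 9, σ ^ 3 • Q = Q + (3 : ℕ) • N Q + N (N (N Q)) := by
    intro Q hQ
    have h33 : (3 : ℕ) • N (N Q) = 0 := (hmem3_iff _).mp (hNN9 Q hQ)
    rw [hcube, h33, add_zero]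
  rintro ⟨m, hm⟩
  by_cases h3m : 3 ∣ m
  · -- then `σ³ = 1` on `E[9]`
    obtain ⟨Q, hQ, hne⟩ := h9
    exact hne (by rw [hm Q hQ, add_smul, one_smul, h3of9 Q hQ m h3m, add_zero])
  · -- the relation `3 N Q + N³ Q = (3m) Q` on `E[9]`
    have hrel : ∀ Q ∈ geomTorsion W 9, (3 : ℕ) • N Q + N (N (N Q)) = (3 * m) • Q := by
      intro Q hQ
      have h := hm Q hQ
      rw [hσ3 Q hQ, add_smul, one_smul, add_assoc] at h
      exact add_left_cancel h
    -- applied to `N Q`: `(3m) N Q = 3 N²Q + N⁴ Q = 0`, so `3 N Q = 0`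
    have h3N : ∀ Q ∈ geomTorsion W 9, (3 : ℕ) • N Q = 0 := by
      intro Q hQ
      have h := hrel (N Q) (hmem9N Q hQ)
      rw [(hmem3_iff _).mp (hNN9 Q hQ), hN4 Q hQ, add_zero] at h
      exact three_smul_eq_zero_of_not_dvd W (h9Q _ (hmem9N Q hQ)) h.symm h3m
    -- hence `N Q ∈ E[3]`, `N³ Q = 0`, and `(3m) Q = 0` on `E[9]`
    have h3mQ : ∀ Q ∈ geomTorsion W 9, (3 : ℕ) • Q = 0 := by
      intro Q hQ
      have hNQ3 : N Q ∈ geomTorsion W 3 := (hmem3_iff _).mpr (h3N Q hQ)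
      have h := hrel Q hQ
      rw [h3N Q hQ, hNN3 _ hNQ3, add_zero] at h
      exact three_smul_eq_zero_of_not_dvd W (h9Q Q hQ) h.symm h3m
    -- but `E[9]` has a point of order `9`: `3 Q₀ = P₀ ≠ 0`
    haveI : Fact (Nat.Prime 3) := ⟨Nat.prime_three⟩
    have hcard : Nat.card (geomTorsion W ((3 : ℕ) : ℤ)) = 3 ^ 2 :=
      card_torsionPoints_eq_sq_holds W (AlgebraicClosure ℚ) (n := 3) (by norm_num)
    haveI : Finite (geomTorsion W ((3 : ℕ) : ℤ)) := Nat.finite_of_card_ne_zero (by rw [hcard]; norm_num)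
    have hnt : Nontrivial (geomTorsion W ((3 : ℕ) : ℤ)) := by
      rw [← Finite.one_lt_card_iff_nontrivial, hcard]; norm_num
    obtain ⟨⟨P₀, hP₀⟩, hP₀0⟩ := exists_ne (0 : geomTorsion W ((3 : ℕ) : ℤ))
    have hP₀ne : P₀ ≠ 0 := fun h ↦ hP₀0 (Subtype.ext h)
    obtain ⟨Q₀, hQ₀⟩ := W.zsmul_geomPoints_surjective_holds (n := 3) (by norm_num) P₀
    have hQz : (3 : ℤ) • Q₀ = P₀ := hQ₀
    have hQ₀' : (3 : ℕ) • Q₀ = P₀ := by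
      rw [show (3 : ℤ) = ((3 : ℕ) : ℤ) by norm_num, natCast_zsmul] at hQz
      exact hQz
    have hQ₀9 : Q₀ ∈ geomTorsion W 9 := by
      apply mem_of_zsmul_eq_zero₉ W
      rw [show (9 : ℤ) = 3 * 3 by norm_num, mul_smul, hQz]
      exact_mod_cast zsmul_eq_zero_of_mem₉ W hP₀
    exact hP₀ne (by rw [← hQ₀']; exact h3mQ Q₀ hQ₀9)

/-- **The witness, packaged.**  Under `h3`, `h9` the element `τ = σ³` fixes `E[3]` pointwise and is
not a scalar `1 + 3m` on `E[9]` — the hypotheses `h1`, `hns` of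
`forall_hasSurjectiveModNGaloisRep_three_pow_of_fixing_torsion_of_nonscalar`. [cite: Serre1972, §4.1] -/
theorem exists_fixing_three_nonscalar_nine_of_orderNine (σ : Field.absoluteGaloisGroup ℚ)
    (h3 : ∀ P ∈ geomTorsion W 3, σ ^ 3 • P = P) (h9 : ∃ Q ∈ geomTorsion W 9, σ ^ 3 • Q ≠ Q) :
    ∃ τ : Field.absoluteGaloisGroup ℚ, (∀ P ∈ geomTorsion W 3, τ • P = P) ∧
      ¬ ∃ m : ℕ, ∀ Q ∈ geomTorsion W 9, τ • Q = (1 + 3 * m) • Q :=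
  ⟨σ ^ 3, h3, not_exists_scalar_pow_three_of_pow_three W σ h3 h9⟩

/-! ### §3 The tower and Kato's (12.5.2) -/

/-- **The `3`-adic tower from surj(3) and ONE element of order nine on `E[9]`.**  If `ρ̄_{E,3}` is
onto and some `σ ∈ Γ_ℚ` has `σ³ = 1` on `E[3]` but `σ³ ≠ 1` on `E[9]`, then `ρ̄_{E,3ⁿ}` is onto for
every `n`.  No reduction hypothesis, no unipotency on `E[9]`, no determinant condition.
[cite: SerreAbelianLadic1968, Ch. IV §3.4, Lemma 3 (IV-23)] [cite: Elkies2006, §1] -/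
theorem towerSurj_three_of_surj_of_orderNine (hsurj : W.HasSurjectiveModNGaloisRep 3)
    (σ : Field.absoluteGaloisGroup ℚ)
    (h3 : ∀ P ∈ geomTorsion W 3, σ ^ 3 • P = P) (h9 : ∃ Q ∈ geomTorsion W 9, σ ^ 3 • Q ≠ Q) (n : ℕ) :
    W.HasSurjectiveModNGaloisRep (3 ^ n : ℕ) :=
  W.forall_hasSurjectiveModNGaloisRep_three_pow_of_fixing_torsion_of_nonscalar hsurj (σ ^ 3) h3
    (not_exists_scalar_pow_three_of_pow_three W σ h3 h9) n

/-- **Kato's (12.5.2) at `3` from surj(3) and one element of order nine on `E[9]`.**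
[cite: Kato2004Asterisque, (12.5.2) (p. 222)] [cite: SerreAbelianLadic1968, Ch. IV §3.4, Lemma 3 (IV-23)] -/
theorem imageContainsSL2_three_of_surj_of_orderNine (hsurj : W.HasSurjectiveModNGaloisRep 3)
    (σ : Field.absoluteGaloisGroup ℚ)
    (h3 : ∀ P ∈ geomTorsion W 3, σ ^ 3 • P = P) (h9 : ∃ Q ∈ geomTorsion W 9, σ ^ 3 • Q ≠ Q) :
    Kato2004.ImageContainsSL2 W 3 := by
  haveI : Fact (Nat.Prime 3) := ⟨Nat.prime_three⟩
  exact (Kato2004.imageContainsSL2_iff_forall_hasSurjectiveModNGaloisRep W 3).mpr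
    (towerSurj_three_of_surj_of_orderNine W hsurj σ h3 h9)

/-- **On an EXOTIC row no element of `Γ_ℚ` has order divisible by nine on `E[9]`** (contrapositive
of `towerSurj_three_of_surj_of_orderNine`): if `ρ̄_{E,3}` is onto and `ρ̄_{E,9}` is not, then every
`σ ∈ Γ_ℚ` with `σ³ = 1` on `E[3]` has `σ³ = 1` on `E[9]` — the image of `Γ_ℚ` in `GL₂(ℤ/9)` has
exponent prime to `9` (Elkies' group of order `144`). [cite: Elkies2006, §1–§2] -/
theorem pow_three_smul_eq_self_of_surj_of_not_surj_nine (hsurj : W.HasSurjectiveModNGaloisRep 3)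
    (hnot : ¬ W.HasSurjectiveModNGaloisRep 9) (σ : Field.absoluteGaloisGroup ℚ)
    (h3 : ∀ P ∈ geomTorsion W 3, σ ^ 3 • P = P) : ∀ Q ∈ geomTorsion W 9, σ ^ 3 • Q = Q := by
  by_contra h
  push Not at h
  obtain ⟨Q, hQ, hne⟩ := h
  exact hnot (by simpa using towerSurj_three_of_surj_of_orderNine W hsurj σ h3 ⟨Q, hQ, hne⟩ 2)

end Summit.BirchSwinnertonDyer.Rank1Residual.GaloisImage

end
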